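import Literature.FieldTheory.Regular.RegularExtension
import Literature.AlgebraicGeometry.Motives.GeometricallyReducedPerfectField
import Mathlib.FieldTheory.PurelyInseparable.Basic
import Mathlib.FieldTheory.SeparableClosure
import Mathlib.FieldTheory.PrimitiveElement
import Mathlib.FieldTheory.LinearDisjoint
import HarnessLib

/-!
# `WildQuotients.SummitReduction` (stmt-ResolutionOfSingularities-16324), line `FramePerfect`, stub 1a:
# regular extensions in any characteristic — `K ⊗ₗ M` is a domain

Route `ResolutionOfSingularities/WildQuotients`, crux `SummitReduction`; helper file of stub
`stub_pair_equivariantFibration` (de Jong 1997, Lemma 5.2: "By construction the field extension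
`R(Y) ⊂ R(X')` is separable and `R(Y)` is algebraically closed in `R(X')`. Hence the generic fibre of
`X' → Y` is geometrically reduced and irreducible"). The algebra behind that sentence is Lang,
*Algebra* VIII §4 (regular extensions): if `L` is relatively algebraically closed in `K` and `K/L` is
SEPARABLE, then `K ⊗ₗ M` is an integral domain for every field extension `M/L`. The tree has this in
characteristic `0` only (`Literature.FieldTheory.Regular.isDomain_tensorProduct_of_isAlgClosedIn`,
where separability is automatic and finite extensions are simple). This file proves it in ANY
characteristic, with separability witnessed as in de Jong's proof by a separating transcendental
element: `x ∈ K` transcendental over `L` with `K/L(x)` separable algebraic (and `K/L` finitely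
generated):

* `isDomain_tensorProduct_of_isAlgClosedIn_of_isSeparable`,
  `isField_tensorProduct_of_isAlgClosedIn_of_isSeparable` — for `S/L` finite separable, `S ⊗ₗ K` is
  a field (`S = L(y)`, the minimal polynomial of `y` stays irreducible over `K`);
* `isReduced_tensorProduct_of_separating` — `E ⊗ₗ K` is reduced for every field `E/L`
  (`E ⊗ₗ L(x)` is a domain and `K/L(x)` is étale; the tree's EGA IV₂ 4.3.5 step);
* `isDomain_tensorProduct_of_isPurelyInseparable_of_isReduced` — if `E/S` is purely inseparable,
  `R ⊇ S` is a field and `E ⊗ₛ R` is reduced, then `E ⊗ₛ R` is a domain (Frobenius: every element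
  has a `q ^ n`-th power in `R`);
* `isDomain_tensorProduct_of_finiteDimensional_of_separating`, `…_of_isAlgebraic_of_separating`,
  `isDomain_tensorProduct_of_isAlgClosedIn_of_separating` — the finite, algebraic and general cases
  (split `E ⊇ S ⊇ L` at the separable closure; then Lang's reduction to an algebraic closure and
  the tree's `isDomain_tensorProduct_of_tower`).
-/

set_option linter.dupNamespace false

open scoped TensorProduct Polynomial IntermediateField

namespace Summit.ResolutionOfSingularities.ResolutionOfSingularities.Theorems

open Literature.FieldTheory.Regular

/-! ## Finite separable extensions of the small field -/

/-- **`S ⊗ₗ K` is a domain for `S/L` finite separable and `L` relatively algebraically closed in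
`K`**: `S = L(y)` by the primitive element theorem, `S ≅ L[X]/(h)` with `h` the minimal polynomial
of `y`, which stays irreducible over `K` (its monic factors have coefficients algebraic over `L`),
so `S ⊗ₗ K ≅ K[X]/(h)` is a domain (Lang, *Algebra* VIII §4; the tree's characteristic-`0`
`isDomain_tensorProduct_of_finiteDimensional` with the primitive element taken from separability).
[cite: Lang2002, VIII §4] -/
theorem isDomain_tensorProduct_of_isAlgClosedIn_of_isSeparable {L K S : Type*} [Field L]
    [Field K] [Algebra L K] [Field S] [Algebra L S] [FiniteDimensional L S]
    [Algebra.IsSeparable L S]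
    (hrac : ∀ z : K, IsAlgebraic L z → z ∈ Set.range (algebraMap L K)) : IsDomain (S ⊗[L] K) := by
  obtain ⟨y, hy⟩ := Field.exists_primitive_element L S
  have hyi : IsIntegral L y := Algebra.IsIntegral.isIntegral y
  set h := minpoly L y with hh
  have hprime : Prime (h.map (algebraMap L K)) :=
    (irreducible_map_of_isAlgClosedIn hrac (minpoly.monic hyi) (minpoly.irreducible hyi)).prime
  haveI : IsDomain (K ⊗[L] AdjoinRoot h) := isDomain_tensorProduct_adjoinRoot hprime
  let eS : S ≃ₐ[L] AdjoinRoot h :=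
    (IntermediateField.topEquiv.symm.trans (IntermediateField.equivOfEq hy.symm)).trans
      (IntermediateField.adjoinRootEquivAdjoin L hyi).symm
  let e : S ⊗[L] K ≃ₐ[L] K ⊗[L] AdjoinRoot h :=
    (Algebra.TensorProduct.congr eS (AlgEquiv.refl : K ≃ₐ[L] K)).trans
      (Algebra.TensorProduct.comm L (AdjoinRoot h) K)
  exact MulEquiv.isDomain (K ⊗[L] AdjoinRoot h) e.toMulEquiv

/-- For `S/L` finite separable and `L` relatively algebraically closed in `K`, `S ⊗ₗ K` is a
FIELD (a domain, algebraic over the field `K`). [cite: Lang2002, VIII §4] -/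
theorem isField_tensorProduct_of_isAlgClosedIn_of_isSeparable {L K S : Type*} [Field L]
    [Field K] [Algebra L K] [Field S] [Algebra L S] [FiniteDimensional L S]
    [Algebra.IsSeparable L S]
    (hrac : ∀ z : K, IsAlgebraic L z → z ∈ Set.range (algebraMap L K)) : IsField (S ⊗[L] K) := by
  haveI := isDomain_tensorProduct_of_isAlgClosedIn_of_isSeparable (S := S) hrac
  exact Algebra.TensorProduct.isField_of_isAlgebraic L S K (Or.inl inferInstance)

/-! ## Separating transcendental element: reducedness -/

/-- **`E ⊗ₗ K` is reduced** for every field `E ⊇ L` when `K/L` is finitely generated and has a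
separating transcendental element `x` (`x` transcendental over `L`, `K/L(x)` separable algebraic):
`E ⊗ₗ L(x)` is a domain (`L(x)` purely transcendental) and `K/L(x)` is finite étale, so
`E ⊗ₗ K ≅ (L(x) ⊗ₗ E) ⊗_{L(x)} K` is étale over a domain, hence reduced (EGA IV₂ 4.3.5; the tree's
`isReduced_tensorProduct_of_isSeparable_of_isDomain`).
[cite: GrothendieckDieudonne1965, Prop. (4.3.5), p. 58] -/
theorem isReduced_tensorProduct_of_separating {L K : Type*} [Field L] [Field K] [Algebra L K]
    [Algebra.EssFiniteType L K] (x : K) (hx : Transcendental L x)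
    [Algebra.IsSeparable L⟮x⟯ K] (E : Type*) [Field E] [Algebra L E] : IsReduced (E ⊗[L] K) := by
  haveI : IsDomain (E ⊗[L] L⟮x⟯) := by
    have hind : AlgebraicIndependent L (fun _ : Unit => x) :=
      algebraicIndependent_unique_type_iff.mpr hx
    have h :=
      Literature.AlgebraicGeometry.Motives.isDomain_tensorProduct_adjoin_of_algebraicIndependent
        (L := E) hind
    rwa [Set.range_const] at h
  exact Literature.AlgebraicGeometry.Motives.isReduced_tensorProduct_of_isSeparable_of_isDomain
    L E L⟮x⟯ K

/-! ## Purely inseparable extensions of the small field: Frobenius -/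

/-- **Frobenius trick.** Let `E/S` be a purely inseparable field extension and `R` an
`S`-algebra. Every element `z` of `E ⊗ₛ R` has a power `z ^ (q ^ n)` (`q` the exponential
characteristic) in the image of `R`: true for pure tensors `e ⊗ r` since `e ^ (q ^ n) ∈ S`, and
`(a + b) ^ (q ^ n) = a ^ (q ^ n) + b ^ (q ^ n)`. [folklore] -/
theorem exists_pow_mem_range_includeRight_of_isPurelyInseparable {S E R : Type*} [Field S]
    [Field E] [Algebra S E] [IsPurelyInseparable S E] [CommRing R] [Algebra S R] (q : ℕ)
    [ExpChar S q] [ExpChar (E ⊗[S] R) q] (z : E ⊗[S] R) :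
    ∃ n : ℕ, z ^ q ^ n ∈ Set.range
      (Algebra.TensorProduct.includeRight : R →ₐ[S] E ⊗[S] R) := by
  induction z using TensorProduct.induction_on with
  | zero => exact ⟨0, 0, by simp⟩
  | tmul e r =>
    obtain ⟨n, c, hc⟩ := IsPurelyInseparable.pow_mem S q e
    refine ⟨n, c • r ^ q ^ n, ?_⟩
    rw [Algebra.TensorProduct.tmul_pow, ← hc, Algebra.TensorProduct.includeRight_apply,
      TensorProduct.tmul_smul, TensorProduct.smul_tmul', Algebra.algebraMap_eq_smul_one]
  | add a b ha hb =>
    obtain ⟨m, c, hc⟩ := ha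
    obtain ⟨n, d, hd⟩ := hb
    refine ⟨m + n, c ^ q ^ n + d ^ q ^ m, ?_⟩
    rw [add_pow_expChar_pow, map_add, map_pow, map_pow, hc, hd, ← pow_mul, ← pow_add,
      ← pow_mul, ← pow_add, add_comm n m]

/-- **A reduced `E ⊗ₛ R` with `E/S` purely inseparable and `R` a field is a domain**: if
`z * w = 0` then `z ^ (q ^ m) * w ^ (q ^ n) = 0` is a product of two elements of (the image of)
the field `R`, so one of them vanishes, and then `z = 0` or `w = 0` by reducedness. (The local
form of "a purely inseparable base change is a universal homeomorphism".) [folklore] -/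
theorem isDomain_tensorProduct_of_isPurelyInseparable_of_isReduced {S E R : Type*} [Field S]
    [Field E] [Algebra S E] [IsPurelyInseparable S E] [CommRing R] [Algebra S R] (hR : IsField R)
    [IsReduced (E ⊗[S] R)] : IsDomain (E ⊗[S] R) := by
  classical
  letI : Field R := hR.toField
  let q := ringExpChar S
  haveI hq : ExpChar S q := inferInstance
  let ι : R →ₐ[S] E ⊗[S] R := Algebra.TensorProduct.includeRight
  have hι : Function.Injective ι :=
    Algebra.TensorProduct.includeRight_injective (algebraMap S E).injective
  have hinjR : Function.Injective (algebraMap S (E ⊗[S] R)) := by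
    have : algebraMap S (E ⊗[S] R) = ι.toRingHom.comp (algebraMap S R) := by
      ext c
      simp [ι]
    rw [this]
    exact hι.comp (algebraMap S R).injective
  haveI : ExpChar (E ⊗[S] R) q := expChar_of_injective_algebraMap hinjR q
  haveI : Nontrivial (E ⊗[S] R) :=
    Algebra.TensorProduct.nontrivial_of_algebraMap_injective_of_isDomain S E R
      (algebraMap S E).injective (algebraMap S R).injective
  haveI : NoZeroDivisors (E ⊗[S] R) := by
    refine ⟨fun {z w} hzw => ?_⟩
    obtain ⟨m, c, hc⟩ := exists_pow_mem_range_includeRight_of_isPurelyInseparable (R := R) q z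
    obtain ⟨n, d, hd⟩ := exists_pow_mem_range_includeRight_of_isPurelyInseparable (R := R) q w
    have hcd : ι (c ^ q ^ n * d ^ q ^ m) = ι 0 := by
      rw [map_zero, map_mul, map_pow, map_pow]
      change (ι c) ^ q ^ n * (ι d) ^ q ^ m = 0
      rw [hc, hd, ← pow_mul, ← pow_add, ← pow_mul, ← pow_add, add_comm n m, ← mul_pow, hzw,
        zero_pow (expChar_pow_pos S q _).ne']
    rcases mul_eq_zero.mp (hι hcd) with h0 | h0
    · left
      have hc0 : c = 0 := (pow_eq_zero_iff (expChar_pow_pos S q n).ne').mp h0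
      have hz : z ^ q ^ m = 0 := by
        rw [← hc, hc0]
        exact map_zero ι
      exact IsReduced.eq_zero z ⟨_, hz⟩
    · right
      have hd0 : d = 0 := (pow_eq_zero_iff (expChar_pow_pos S q m).ne').mp h0
      have hw : w ^ q ^ n = 0 := by
        rw [← hd, hd0]
        exact map_zero ι
      exact IsReduced.eq_zero w ⟨_, hw⟩
  exact NoZeroDivisors.to_isDomain _

/-! ## The finite, algebraic and general cases -/

/-- **Tower step.** Let `L` be relatively algebraically closed in the finitely generated
extension `K`, with a separating transcendental element `x`, and let `L ⊆ S ⊆ E` be fields with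
`S/L` finite separable and `E/S` purely inseparable. Then `E ⊗ₗ K` is a domain: `S ⊗ₗ K` is a
field, `E ⊗ₗ K ≅ E ⊗ₛ (S ⊗ₗ K)` is reduced (`isReduced_tensorProduct_of_separating`) and the
Frobenius trick applies. (Stated for an abstract `S` to keep instance paths short; used with `S`
the separable closure of `L` in `E`.) [cite: Lang2002, VIII §4] -/
theorem isDomain_tensorProduct_of_isPurelyInseparable_tower {L K S E : Type*} [Field L]
    [Field K] [Algebra L K] [Algebra.EssFiniteType L K]
    (hrac : ∀ z : K, IsAlgebraic L z → z ∈ Set.range (algebraMap L K)) (x : K)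
    (hx : Transcendental L x) [Algebra.IsSeparable L⟮x⟯ K] [Field S] [Algebra L S]
    [FiniteDimensional L S] [Algebra.IsSeparable L S] [Field E] [Algebra L E] [Algebra S E]
    [IsScalarTower L S E] [IsPurelyInseparable S E] : IsDomain (E ⊗[L] K) := by
  have hF : IsField (S ⊗[L] K) :=
    isField_tensorProduct_of_isAlgClosedIn_of_isSeparable (S := S) hrac
  let e : E ⊗[S] (S ⊗[L] K) ≃ₐ[E] E ⊗[L] K := Algebra.TensorProduct.cancelBaseChange L S E E K
  haveI : IsReduced (E ⊗[L] K) := isReduced_tensorProduct_of_separating x hx E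
  haveI : IsReduced (E ⊗[S] (S ⊗[L] K)) := isReduced_of_injective e e.injective
  haveI : IsDomain (E ⊗[S] (S ⊗[L] K)) :=
    isDomain_tensorProduct_of_isPurelyInseparable_of_isReduced hF
  exact MulEquiv.isDomain (E ⊗[S] (S ⊗[L] K)) e.symm.toMulEquiv

/-- **Finite extensions.** Let `L` be relatively algebraically closed in the finitely generated
extension `K`, with a separating transcendental element `x`. Then `E ⊗ₗ K` is a domain for every
FINITE extension `E/L` (the tower step at the separable closure `S` of `L` in `E`: `S/L` is finite
separable and `E/S` purely inseparable). (Lang VIII §4: `K/L` regular ⇒ `K` linearly disjoint from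
`L^alg`.) [cite: Lang2002, VIII §4] -/
theorem isDomain_tensorProduct_of_finiteDimensional_of_separating {L K E : Type*} [Field L]
    [Field K] [Algebra L K] [Algebra.EssFiniteType L K]
    (hrac : ∀ z : K, IsAlgebraic L z → z ∈ Set.range (algebraMap L K)) (x : K)
    (hx : Transcendental L x) [Algebra.IsSeparable L⟮x⟯ K] [Field E] [Algebra L E]
    [FiniteDimensional L E] : IsDomain (E ⊗[L] K) :=
  haveI : IsPurelyInseparable (separableClosure L E) E := separableClosure.isPurelyInseparable L E
  isDomain_tensorProduct_of_isPurelyInseparable_tower (S := separableClosure L E) hrac x hx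

/-- **Algebraic extensions.** Under the same hypotheses `K ⊗ₗ E` is a domain for every ALGEBRAIC
extension `E/L`: two elements of `E ⊗ₗ K` live in `E₀ ⊗ₗ K` for a finite subextension `E₀` (the
tree's characteristic-`0` argument `isDomain_tensorProduct_of_isAlgebraic`, verbatim but for the
finite case). [cite: Lang2002, VIII §4] -/
theorem isDomain_tensorProduct_of_isAlgebraic_of_separating {L K E : Type*} [Field L]
    [Field K] [Algebra L K] [Algebra.EssFiniteType L K]
    (hrac : ∀ z : K, IsAlgebraic L z → z ∈ Set.range (algebraMap L K)) (x : K)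
    (hx : Transcendental L x) [Algebra.IsSeparable L⟮x⟯ K] [Field E] [Algebra L E]
    [Algebra.IsAlgebraic L E] : IsDomain (K ⊗[L] E) := by
  classical
  haveI : IsDomain (E ⊗[L] K) := by
    haveI : Nontrivial (E ⊗[L] K) :=
      Algebra.TensorProduct.nontrivial_of_algebraMap_injective_of_isDomain L E K
        (FaithfulSMul.algebraMap_injective L E) (FaithfulSMul.algebraMap_injective L K)
    haveI : NoZeroDivisors (E ⊗[L] K) := by
      refine noZeroDivisors_tensorProduct_of_forall_fg fun T hT => ?_
      obtain ⟨s, hs⟩ := hT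
      set E₀ : IntermediateField L E := IntermediateField.adjoin L (s : Set E) with hE₀
      haveI : FiniteDimensional L E₀ :=
        IntermediateField.finiteDimensional_adjoin fun z _ => Algebra.IsIntegral.isIntegral z
      have hle : T ≤ E₀.toSubalgebra := by
        rw [← hs]
        exact Algebra.adjoin_le (IntermediateField.subset_adjoin L _)
      haveI : IsDomain (E₀ ⊗[L] K) :=
        isDomain_tensorProduct_of_finiteDimensional_of_separating hrac x hx
      let ι : T ⊗[L] K →ₐ[L] E₀ ⊗[L] K :=
        Algebra.TensorProduct.map (Subalgebra.inclusion hle) (AlgHom.id L K)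
      have hι : Function.Injective ι := by
        have : (ι : T ⊗[L] K → E₀ ⊗[L] K) =
            LinearMap.rTensor K (Subalgebra.inclusion hle).toLinearMap := by
          ext z
          induction z using TensorProduct.induction_on with
          | zero => simp
          | tmul a b => simp [ι]
          | add u v hu hv => rw [map_add, map_add, hu, hv]
        rw [this]
        exact Module.Flat.rTensor_preserves_injective_linearMap _
          (Subalgebra.inclusion_injective hle)
      exact hι.noZeroDivisors ι (map_zero ι) (map_mul ι)
    exact NoZeroDivisors.to_isDomain _
  exact MulEquiv.isDomain (E ⊗[L] K) (Algebra.TensorProduct.comm L K E).toMulEquiv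

/-- **Regular extensions are geometrically integral, any characteristic** (Lang, *Algebra*
VIII §4, Thm. 4.12 with Cor. 4.14; Bourbaki, *Algèbre* V §17): let `L ⊆ K` be fields with `K/L`
finitely generated, `L` relatively algebraically closed in `K`, and `K/L` separable in the sense
that some `x ∈ K` transcendental over `L` has `K/L(x)` separable algebraic. Then `K ⊗ₗ M` is an
integral domain for EVERY field extension `M/L`. (Embed `M` in an algebraic closure `M̄`, let `L̄`
be the algebraic closure of `L` in `M̄`; `K ⊗ₗ L̄` is a domain by the algebraic case and
`K ⊗ₗ M̄ ≅ (L̄ ⊗ₗ K) ⊗_{L̄} M̄` is a tensor product of domains over an algebraically closed field —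
the tree's `isDomain_tensorProduct_of_tower`.) This is the sentence "`R(Y)` is algebraically
closed in `R(X')` and `R(X')/R(Y)` separable ⇒ the generic fibre is geometrically integral" of
de Jong 1997, Lemma 5.2. [cite: Lang2002, VIII §4] -/
theorem isDomain_tensorProduct_of_isAlgClosedIn_of_separating {L K M : Type*} [Field L]
    [Field K] [Algebra L K] [Algebra.EssFiniteType L K]
    (hrac : ∀ z : K, IsAlgebraic L z → z ∈ Set.range (algebraMap L K)) (x : K)
    (hx : Transcendental L x) [Algebra.IsSeparable L⟮x⟯ K] [Field M] [Algebra L M] :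
    IsDomain (K ⊗[L] M) := by
  classical
  haveI : IsAlgClosed (algebraicClosure L (AlgebraicClosure M)) := IsAlgClosure.isAlgClosed L
  haveI : IsDomain (K ⊗[L] algebraicClosure L (AlgebraicClosure M)) :=
    isDomain_tensorProduct_of_isAlgebraic_of_separating hrac x hx
  haveI : IsDomain (algebraicClosure L (AlgebraicClosure M) ⊗[L] K) :=
    MulEquiv.isDomain (K ⊗[L] algebraicClosure L (AlgebraicClosure M))
      (Algebra.TensorProduct.comm L _ K).toMulEquiv
  haveI : IsDomain (K ⊗[L] AlgebraicClosure M) :=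
    isDomain_tensorProduct_of_tower (Lb := algebraicClosure L (AlgebraicClosure M))
  haveI : Nontrivial (K ⊗[L] M) :=
    Algebra.TensorProduct.nontrivial_of_algebraMap_injective_of_isDomain L K M
      (FaithfulSMul.algebraMap_injective L K) (FaithfulSMul.algebraMap_injective L M)
  let j : K ⊗[L] M →ₐ[K] K ⊗[L] AlgebraicClosure M :=
    Algebra.TensorProduct.map (AlgHom.id K K) (IsScalarTower.toAlgHom L M (AlgebraicClosure M))
  have hj : Function.Injective j := by
    have : (j : K ⊗[L] M → K ⊗[L] AlgebraicClosure M) =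
        LinearMap.lTensor K (IsScalarTower.toAlgHom L M (AlgebraicClosure M)).toLinearMap := by
      ext z
      induction z using TensorProduct.induction_on with
      | zero => simp
      | tmul a b => simp [j]
      | add u v hu hv => rw [map_add, map_add, hu, hv]
    rw [this]
    exact Module.Flat.lTensor_preserves_injective_linearMap _
      (algebraMap M (AlgebraicClosure M)).injective
  haveI : NoZeroDivisors (K ⊗[L] M) := hj.noZeroDivisors j (map_zero j) (map_mul j)
  exact NoZeroDivisors.to_isDomain _

end Summit.ResolutionOfSingularities.ResolutionOfSingularities.Theorems
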